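import Mathlib
import Summits.Ventures.PercRepro2.TypedRulesSt
import Summits.Ventures.PercRepro2.TypedResidual

/-!
# The residual-class spine for STATE KERNELS (blind cell PercRepro2, p2 g0, 2026-08-25; sub-claim
S1, `proofs/subclaims/S1-REDUCTION.md`; the lead's ruling INBOX 2026-08-25T01:33:49Z (1))

The spine of sub-claim S1 (`typedCount_nonneg_of_residual`, TypedResidual.lean) made reusable:
for EVERY kernel `stKer KK` factoring through the states and satisfying the two kernel-specific
facts of the calculus (`RuleKernel KK`: vanishing when a copy has `a₁ ↔ a₂`; the `b`- and
`o`-decompositions with their kill identities), nonnegativity of the typed counts on the FULLY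
REDUCED typed graphs (`Reduced`, the same seven rules) at the all-closed pinning gives
nonnegativity on every instance (`typedCount_nonneg_of_reduced_st`) — strong induction on
`redMeasure` with the `_st` rules of TypedRulesSt.lean, plus the pinned-loop rule
`typedCount_pinned_loop_st`. The base of the induction is the user's: split `hNR` on whatever
base the kernel has (for `K₃`: `|F| ≤ 5` and the four-mark vanishing; for the case-1 kernel (ii):
the all-marked instances). `ruleKernel_KB` checks that `K₃`'s own kernel `KB` satisfies
`RuleKernel`, so `typedCount_nonneg_of_residual` is the instance `KK = KB` of this theorem modulo
the base. Own code; standard axioms.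
-/

namespace Summit.Ventures.PercRepro2

open UnionCluster

namespace CovForm

namespace TypedRed

open OneTyped Contract Untouched

section Kernel

variable {R : Type*} [Field R]

/-- The two kernel-specific inputs of the reduction calculus: the kernel vanishes when some copy
has `a₁ ↔ a₂`, and it decomposes by the copy carrying the `b`- (resp. `o`-) factor with the kill
identity of the pendant rule. -/
structure RuleKernel (KK : St → St → St → R) : Prop where
  root_pair : ∀ x y w : St, x.q' = true ∨ y.q' = true ∨ w.q' = true → KK x y w = 0
  pendant_b : ∃ KKx KKy KKz : St → St → St → R,
    (∀ x y w : St, KK x y w = KKx x y w + KKy x y w + KKz x y w) ∧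
    ∀ (p q r : Bool) (x y w : St),
      KK (cond p x (killB x)) (cond q y (killB y)) (cond r w (killB w)) =
        (if p then KKx x y w else 0) + (if q then KKy x y w else 0) + (if r then KKz x y w else 0)
  pendant_o : ∃ KKx KKy KKz : St → St → St → R,
    (∀ x y w : St, KK x y w = KKx x y w + KKy x y w + KKz x y w) ∧
    ∀ (p q r : Bool) (x y w : St),
      KK (cond p x (killO x)) (cond q y (killO y)) (cond r w (killO w)) =
        (if p then KKx x y w else 0) + (if q then KKy x y w else 0) + (if r then KKz x y w else 0)

/-- **`K₃`'s kernel satisfies the calculus' inputs** (`KB_eq_zero_of_q'`, `KB_killB`, `KB_killO`). -/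
theorem ruleKernel_KB : RuleKernel (fun x y w : St => ((KB x y w : ℤ) : R)) where
  root_pair := fun x y w h => by rw [KB_eq_zero_of_q' x y w h]; simp
  pendant_b := ⟨fun _ _ _ => 0, fun x y w => ((KBy x y w : ℤ) : R), fun x y w => ((KBz x y w : ℤ) : R),
    fun x y w => by rw [KB_eq_KBy_add_KBz]; push_cast; ring,
    fun p q r x y w => by
      rw [KB_killB]
      cases p <;> cases q <;> cases r <;> simp⟩
  pendant_o := ⟨fun x y w => ((KOx x y w : ℤ) : R), fun x y w => ((KOy x y w : ℤ) : R),
    fun x y w => ((KOz x y w : ℤ) : R),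
    fun x y w => by rw [KB_eq_KOx_add]; push_cast; ring,
    fun p q r x y w => by
      rw [KB_killO]
      cases p <;> cases q <;> cases r <;> simp⟩

end Kernel

section PinnedLoop

variable {V : Type*} {E : Type*} [Fintype E] [DecidableEq E] {R : Type*} [Field R]

/-- **Pinned loop** for a state kernel. -/
theorem typedCount_pinned_loop_st (ends : E → Sym2 V) (o a₁ a₂ a₃ b : V) (KK : St → St → St → R)
    {g : E} {u : V} (hg : ends g = s(u, u)) (F : Finset E) (hgF : g ∉ F) (z : Config E)
    (hz : z g = true) (τ : E → ℕ) :
    typedCount F z τ (stKer ends o a₁ a₂ a₃ b KK) =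
      typedCount F (Function.update z g false) τ (stKer ends o a₁ a₂ a₃ b KK) := by
  have h1 := typedCount_insert_pinned F g hgF z τ (stKer ends o a₁ a₂ a₃ b KK)
  rw [hz] at h1
  have h3 : (if true = true then 3 else 0) = 3 := rfl
  rw [h3] at h1
  rw [← h1, typedCount_loop_st ends o a₁ a₂ a₃ b KK hg (insert g F) (Finset.mem_insert_self g F) z,
    Function.update_self, Nat.choose_self, Nat.cast_one, one_mul, Function.update_idem,
    typedCount_type_zero (insert g F) g (Finset.mem_insert_self g F) z _
      (Function.update_self g 0 τ), Finset.erase_insert hgF]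
  exact typedCount_congr_τ F _ (fun e he => Function.update_of_ne (fun h : e = g => hgF (h ▸ he)) 0 τ) _

end PinnedLoop

section Spine

variable {V : Type*} {E : Type*} [DecidableEq V] [Fintype E] [DecidableEq E] {R : Type*} [Field R]
  [LinearOrder R] [IsStrictOrderedRing R]

/-- **THE SPINE FOR STATE KERNELS**: for a kernel satisfying `RuleKernel`, nonnegativity of the typed
counts on every fully reduced typed graph (at the all-closed pinning) gives nonnegativity on every
instance — strong induction on `redMeasure`, each rule of the calculus rewriting the count into a
nonnegative combination of counts of smaller measure. -/
theorem typedCount_nonneg_of_reduced_st (KK : St → St → St → R) (hK : RuleKernel KK)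
    (hNR : ∀ (ends : E → Sym2 V) (o a₁ a₂ a₃ b : V) (F : Finset E) (τ : E → ℕ),
      (∀ e ∈ F, τ e = 1 ∨ τ e = 2) → Reduced ends o a₁ a₂ a₃ b F →
        0 ≤ typedCount F (fun _ => false) τ (stKer ends o a₁ a₂ a₃ b KK))
    (ends : E → Sym2 V) (o a₁ a₂ a₃ b : V) (F : Finset E) (z : Config E) (τ : E → ℕ)
    (hτ : ∀ e ∈ F, τ e = 1 ∨ τ e = 2) :
    0 ≤ typedCount F z τ (stKer ends o a₁ a₂ a₃ b KK) := by
  generalize hn : redMeasure ends F z = n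
  induction n using Nat.strong_induction_on generalizing ends o a₁ a₂ a₃ b F z τ with
  | _ n ih =>
  -- the rules in the order contraction, pinned loop, root pair, typed loop, unmarked leaf,
  -- pendant `b`, pendant `o`, parallel, series; last the reduced case
  by_cases hc : ∃ g, g ∉ F ∧ z g = true ∧ ¬ (ends g).IsDiag
  · obtain ⟨g, hgF, hz, hnd⟩ := hc
    obtain ⟨⟨u, v⟩, huv⟩ := Quot.exists_rep (ends g)
    have hg : ends g = s(u, v) := huv.symm
    have huv' : u ≠ v := by
      intro h
      apply hnd
      rw [hg, Sym2.mk_isDiag_iff]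
      exact h
    rw [typedCount_contract_open_st ends o a₁ a₂ a₃ b KK hg F hgF z hz τ]
    exact ih _ (by rw [← hn]; exact redMeasure_contract_lt ends hg huv' hgF hz) _ _ _ _ _ _ F z τ
      hτ rfl
  by_cases hl : ∃ g, g ∉ F ∧ z g = true ∧ (ends g).IsDiag
  · obtain ⟨g, hgF, hz, hd⟩ := hl
    obtain ⟨⟨u, v⟩, huv⟩ := Quot.exists_rep (ends g)
    have hg : ends g = s(u, v) := huv.symm
    have huv' : u = v := by
      rw [hg, Sym2.mk_isDiag_iff] at hd
      exact hd
    subst huv'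
    rw [typedCount_pinned_loop_st ends o a₁ a₂ a₃ b KK hg F hgF z hz τ]
    exact ih _ (by rw [← hn]; exact redMeasure_update_closed_lt ends hgF hz) _ _ _ _ _ _ F _ τ
      hτ rfl
  by_cases hr : ∃ f ∈ F, ends f = s(a₁, a₂)
  · obtain ⟨f, hfF, hf⟩ := hr
    have h1 : 1 ≤ τ f := by rcases hτ f hfF with h | h <;> omega
    rw [typedCount_root_pair_st ends o a₁ a₂ a₃ b KK hK.root_pair hf F hfF z τ h1]
  by_cases htl : ∃ f ∈ F, (ends f).IsDiag
  · obtain ⟨f, hfF, hd⟩ := htl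
    obtain ⟨⟨u, v⟩, huv⟩ := Quot.exists_rep (ends f)
    have hf : ends f = s(u, v) := huv.symm
    have huv' : u = v := by
      rw [hf, Sym2.mk_isDiag_iff] at hd
      exact hd
    subst huv'
    rw [typedCount_loop_st ends o a₁ a₂ a₃ b KK hf F hfF z τ,
      typedCount_type_zero F _ hfF z _ (Function.update_self _ _ _),
      typedCount_congr_τ (F.erase _) _ (τ' := τ)
        (fun e he => Function.update_of_ne (Finset.ne_of_mem_erase he) _ _)]
    exact mul_nonneg (Nat.cast_nonneg _)
      (ih _ (by rw [← hn]; exact redMeasure_erase_update_lt ends hfF z false) _ _ _ _ _ _ _ _ τ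
        (fun e he => hτ e (Finset.mem_of_mem_erase he)) rfl)
  by_cases hleaf : ∃ f ∈ F, ∃ l u : V, ends f = s(l, u) ∧ l ≠ u ∧ l ≠ o ∧ l ≠ a₁ ∧ l ≠ a₂ ∧
      l ≠ a₃ ∧ l ≠ b ∧ (∀ e', e' ≠ f → l ∈ ends e' → e' ∉ F ∧ z e' = false)
  · obtain ⟨f, hfF, l, u, hf, hlu, hlo, hl1, hl2, hl3, hlb, hcl⟩ := hleaf
    rw [typedCount_unmarked_leaf_st ends o a₁ a₂ a₃ b KK hf hlu hlo hl1 hl2 hl3 hlb F hfF z τ hcl,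
      typedCount_type_zero F _ hfF z _ (Function.update_self _ _ _),
      typedCount_congr_τ (F.erase _) _ (τ' := τ)
        (fun e he => Function.update_of_ne (Finset.ne_of_mem_erase he) _ _)]
    exact mul_nonneg (Nat.cast_nonneg _)
      (ih _ (by rw [← hn]; exact redMeasure_erase_update_lt ends hfF z false) _ _ _ _ _ _ _ _ τ
        (fun e he => hτ e (Finset.mem_of_mem_erase he)) rfl)
  by_cases hpb : ∃ f ∈ F, ∃ u : V, ends f = s(b, u) ∧ b ≠ u ∧ b ≠ o ∧ b ≠ a₁ ∧ b ≠ a₂ ∧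
      b ≠ a₃ ∧ (∀ e', e' ≠ f → b ∈ ends e' → e' ∉ F ∧ z e' = false)
  · obtain ⟨f, hfF, u, hf, hbu, hbo, hb1, hb2, hb3, hcl⟩ := hpb
    have h1 : 1 ≤ τ f := by rcases hτ f hfF with h | h <;> omega
    obtain ⟨KKx, KKy, KKz, hsum, hkill⟩ := hK.pendant_b
    rw [typedCount_pendant_b_st ends o a₁ a₂ a₃ b KK KKx KKy KKz hsum hkill hf hbu hbo hb1 hb2 hb3 F
        hfF z τ h1 hcl,
      typedCount_type_three F _ hfF z _ (Function.update_self _ _ _),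
      typedCount_congr_τ (F.erase _) _ (τ' := τ)
        (fun e he => Function.update_of_ne (Finset.ne_of_mem_erase he) _ _)]
    exact mul_nonneg (Nat.cast_nonneg _)
      (ih _ (by rw [← hn]; exact redMeasure_erase_update_lt ends hfF z true) _ _ _ _ _ _ _ _ τ
        (fun e he => hτ e (Finset.mem_of_mem_erase he)) rfl)
  by_cases hpo : ∃ f ∈ F, ∃ u : V, ends f = s(o, u) ∧ o ≠ u ∧ o ≠ a₁ ∧ o ≠ a₂ ∧ o ≠ a₃ ∧
      o ≠ b ∧ (∀ e', e' ≠ f → o ∈ ends e' → e' ∉ F ∧ z e' = false)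
  · obtain ⟨f, hfF, u, hf, hou, ho1, ho2, ho3, hob, hcl⟩ := hpo
    have h1 : 1 ≤ τ f := by rcases hτ f hfF with h | h <;> omega
    obtain ⟨KKx, KKy, KKz, hsum, hkill⟩ := hK.pendant_o
    rw [typedCount_pendant_o_st ends o a₁ a₂ a₃ b KK KKx KKy KKz hsum hkill hf hou ho1 ho2 ho3 hob F
        hfF z τ h1 hcl,
      typedCount_type_three F _ hfF z _ (Function.update_self _ _ _),
      typedCount_congr_τ (F.erase _) _ (τ' := τ)
        (fun e he => Function.update_of_ne (Finset.ne_of_mem_erase he) _ _)]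
    exact mul_nonneg (Nat.cast_nonneg _)
      (ih _ (by rw [← hn]; exact redMeasure_erase_update_lt ends hfF z true) _ _ _ _ _ _ _ _ τ
        (fun e he => hτ e (Finset.mem_of_mem_erase he)) rfl)
  by_cases hpar : ∃ e ∈ F, ∃ f ∈ F, e ≠ f ∧ ends e = ends f
  · obtain ⟨e, heF, f, hfF, hef, hpar⟩ := hpar
    have heF' : e ∈ F.erase f := Finset.mem_erase.2 ⟨hef, heF⟩
    rw [typedCount_parallel_st ends o a₁ a₂ a₃ b KK hef hpar F heF hfF z τ (hτ e heF) (hτ f hfF),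
      Finset.sum_range_succ, Finset.sum_range_succ, Finset.sum_range_succ, Finset.sum_range_succ,
      Finset.sum_range_zero, zero_add, muOr_zero _ _ (hτ e heF) (hτ f hfF), Nat.cast_zero, zero_mul,
      zero_add]
    have hτ' : ∀ j, ∀ e' ∈ F.erase f, e' ≠ e →
        Function.update τ e j e' = 1 ∨ Function.update τ e j e' = 2 := by
      intro j e' he' hne
      rw [Function.update_of_ne hne]
      exact hτ e' (Finset.mem_of_mem_erase he')
    have hlt1 : redMeasure ends (F.erase f) (Function.update z f false) < n := by
      rw [← hn]; exact redMeasure_erase_update_lt ends hfF z false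
    refine add_nonneg (add_nonneg (mul_nonneg (Nat.cast_nonneg _) ?_)
      (mul_nonneg (Nat.cast_nonneg _) ?_)) (mul_nonneg (Nat.cast_nonneg _) ?_)
    · refine ih _ hlt1 _ _ _ _ _ _ _ _ _ (fun e' he' => ?_) rfl
      by_cases hne : e' = e
      · subst hne; rw [Function.update_self]; exact Or.inl rfl
      · exact hτ' 1 e' he' hne
    · refine ih _ hlt1 _ _ _ _ _ _ _ _ _ (fun e' he' => ?_) rfl
      by_cases hne : e' = e
      · subst hne; rw [Function.update_self]; exact Or.inr rfl
      · exact hτ' 2 e' he' hne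
    · rw [typedCount_type_three (F.erase f) e heF' _ _ (Function.update_self _ _ _),
        typedCount_congr_τ ((F.erase f).erase e) _ (τ' := τ)
          (fun e' he' => Function.update_of_ne (Finset.ne_of_mem_erase he') _ _)]
      refine ih _ ?_ _ _ _ _ _ _ _ _ τ
        (fun e' he' => hτ e' (Finset.mem_of_mem_erase (Finset.mem_of_mem_erase he'))) rfl
      exact (redMeasure_erase_update_lt ends heF' _ true).trans hlt1
  by_cases hser : ∃ e ∈ F, ∃ f ∈ F, e ≠ f ∧ ∃ u w v : V, ends e = s(u, w) ∧ ends f = s(w, v) ∧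
      w ≠ u ∧ w ≠ v ∧ w ≠ o ∧ w ≠ a₁ ∧ w ≠ a₂ ∧ w ≠ a₃ ∧ w ≠ b ∧
      (∀ e', e' ≠ e → e' ≠ f → w ∈ ends e' → e' ∉ F ∧ z e' = false)
  · obtain ⟨e, heF, f, hfF, hef, u, w, v, he, hf, hwu, hwv, hwo, hw1, hw2, hw3, hwb, hcl⟩ := hser
    have heF' : e ∈ F.erase f := Finset.mem_erase.2 ⟨hef, heF⟩
    rw [typedCount_series_st ends o a₁ a₂ a₃ b KK hef he hf hwu hwv hwo hw1 hw2 hw3 hwb F heF hfF z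
        τ (hτ e heF) (hτ f hfF) hcl,
      Finset.sum_range_succ, Finset.sum_range_succ, Finset.sum_range_succ, Finset.sum_range_succ,
      Finset.sum_range_zero, zero_add, muAnd_three _ _ (hτ e heF) (hτ f hfF), Nat.cast_zero,
      zero_mul, add_zero]
    have hτ' : ∀ j, ∀ e' ∈ F.erase f, e' ≠ e →
        Function.update τ e j e' = 1 ∨ Function.update τ e j e' = 2 := by
      intro j e' he' hne
      rw [Function.update_of_ne hne]
      exact hτ e' (Finset.mem_of_mem_erase he')
    have hlt1 : redMeasure ends (F.erase f) (Function.update z f true) < n := by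
      rw [← hn]; exact redMeasure_erase_update_lt ends hfF z true
    refine add_nonneg (add_nonneg (mul_nonneg (Nat.cast_nonneg _) ?_)
      (mul_nonneg (Nat.cast_nonneg _) ?_)) (mul_nonneg (Nat.cast_nonneg _) ?_)
    · rw [typedCount_type_zero (F.erase f) e heF' _ _ (Function.update_self _ _ _),
        typedCount_congr_τ ((F.erase f).erase e) _ (τ' := τ)
          (fun e' he' => Function.update_of_ne (Finset.ne_of_mem_erase he') _ _)]
      refine ih _ ?_ _ _ _ _ _ _ _ _ τ
        (fun e' he' => hτ e' (Finset.mem_of_mem_erase (Finset.mem_of_mem_erase he'))) rfl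
      exact (redMeasure_erase_update_lt ends heF' _ false).trans hlt1
    · refine ih _ hlt1 _ _ _ _ _ _ _ _ _ (fun e' he' => ?_) rfl
      by_cases hne : e' = e
      · subst hne; rw [Function.update_self]; exact Or.inl rfl
      · exact hτ' 1 e' he' hne
    · refine ih _ hlt1 _ _ _ _ _ _ _ _ _ (fun e' he' => ?_) rfl
      by_cases hne : e' = e
      · subst hne; rw [Function.update_self]; exact Or.inr rfl
      · exact hτ' 2 e' he' hne
  -- no rule applies and the instance is not in the base: it is residual
  have hz0 : ∀ g, g ∉ F → z g = false := by
    intro g hgF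
    by_contra hz
    have hz' : z g = true := by
      cases h : z g
      · exact absurd h hz
      · rfl
    by_cases hd : (ends g).IsDiag
    · exact hl ⟨g, hgF, hz', hd⟩
    · exact hc ⟨g, hgF, hz', hd⟩
  have hRed : Reduced ends o a₁ a₂ a₃ b F :=
    { no_root_pair := fun f hfF hf => hr ⟨f, hfF, hf⟩
      no_loop := fun f hfF hd => htl ⟨f, hfF, hd⟩
      no_parallel := fun e heF f hfF hef hp => hpar ⟨e, heF, f, hfF, hef, hp⟩
      no_leaf := fun f hfF l u hf hlu hlo hl1 hl2 hl3 hlb => by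
        by_contra hno
        refine hleaf ⟨f, hfF, l, u, hf, hlu, hlo, hl1, hl2, hl3, hlb, fun e' hne hl' => ?_⟩
        have hnF : e' ∉ F := fun hF => hno ⟨e', hF, hne, hl'⟩
        exact ⟨hnF, hz0 e' hnF⟩
      no_pendant_b := fun f hfF u hf hbu hbo hb1 hb2 hb3 => by
        by_contra hno
        refine hpb ⟨f, hfF, u, hf, hbu, hbo, hb1, hb2, hb3, fun e' hne hb' => ?_⟩
        have hnF : e' ∉ F := fun hF => hno ⟨e', hF, hne, hb'⟩
        exact ⟨hnF, hz0 e' hnF⟩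
      no_pendant_o := fun f hfF u hf hou ho1 ho2 ho3 hob => by
        by_contra hno
        refine hpo ⟨f, hfF, u, hf, hou, ho1, ho2, ho3, hob, fun e' hne ho' => ?_⟩
        have hnF : e' ∉ F := fun hF => hno ⟨e', hF, hne, ho'⟩
        exact ⟨hnF, hz0 e' hnF⟩
      no_series := fun e heF f hfF hef u w v he hf hwu hwv hwo hw1 hw2 hw3 hwb => by
        by_contra hno
        refine hser ⟨e, heF, f, hfF, hef, u, w, v, he, hf, hwu, hwv, hwo, hw1, hw2, hw3, hwb,
          fun e' hne hnf hw' => ?_⟩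
        have hnF : e' ∉ F := fun hF => hno ⟨e', hF, hne, hnf, hw'⟩
        exact ⟨hnF, hz0 e' hnF⟩ }
  rw [typedCount_congr_z F (z' := fun _ => false) (fun e he => hz0 e he) τ]
  exact hNR ends o a₁ a₂ a₃ b F τ hτ hRed

end Spine

end TypedRed

end CovForm

end Summit.Ventures.PercRepro2
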